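import Summits.QuantumAdvantage.QuantumAdvantage.Theorems.CubicForrelationNearExactIsExactSixteenTypeO

/-!
# Crux `CubicForrelation.NearExactIsExact` (stmt-QuantumAdvantage-14043) — PERIODS pin the Fourier support: an `L¹` bound for
  the transform of a `±1` function on a set with a group of (anti)periods (general `n`)

Certificate seat `b2b-cforr-cert` (gen 6).  HONEST FRAMING: an infrastructure lemma about Boolean/`±1` functions on `𝔽₂ⁿ` (input to
the two-sided analysis of the boundary value `Φ = 31/32` on 16 bits) — NOT summit progress.

Let `A : 𝔽₂ⁿ → ℝ` take values `±1` on a set `S` and `0` off `S`, and let `R ∋ 0` be `⊕`-closed such that every `a ∈ R` is a period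
UP TO SIGN: `A(x ⊕ a) = c_a·A(x)` for all `x`, `c_a = ±1`.  Then (`fp_twist_eq_of_W_ne_zero`) wherever `Â(y) = Σ_x A(x)(−1)^{x·y} ≠ 0`
the character is pinned, `(−1)^{a·y} = c_a`; hence the support of `Â` lies in ONE coset of `R^⊥` and `#supp(Â)·#R ≤ 2ⁿ`
(`fp_card_supp_mul_le`, cf. the landed `st_card_supp_mul_radical_le` for radicals of quadratics); and by Cauchy–Schwarz with Parseval
`Σ Â² = 2ⁿ·#S` (`fp_l1_sq_mul_le`):  `(Σ_y |Â(y)|)² · #R ≤ 4ⁿ · #S`.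
(Used with `R` = the radical of a "quadratic along a flat" sign pattern: few, large frequencies.)

References: R. O'Donnell, *Analysis of Boolean Functions* (2014) §3.3 (Poisson / annihilators); C. Carlet (2021) §5.2.  Everything
below is proved from Mathlib and the tree; axioms are the standard three.
-/

set_option linter.dupNamespace false -- D-0017: single-problem summit ⇒ `QuantumAdvantage.QuantumAdvantage` by design

noncomputable section

namespace Summit.QuantumAdvantage.QuantumAdvantage.Theorems.CubicForrelation.NearExactIsExact

open Finset
open Literature.Computability.QuantumComplexity
open Literature.Computability.QuantumComplexity.BuzetChailloux (bxor zeroVec bxor_bxor_cancel_left bxor_zeroVec zeroVec_bxor bxor_comm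
  twist_bxor_right)
open Literature.Computability.QuantumComplexity.DerivativeWalsh (W sum_W_sq twist_bxor_left card_mul_card_perp)

variable {n : ℕ}

/-- Re-indexing a Walsh transform by a translation: `Â(y) = Σ_x A(x ⊕ a)(−1)^{(x⊕a)·y}`. [folklore] -/
theorem fp_W_translate (A : (Fin n → Bool) → ℝ) (a y : Fin n → Bool) :
    W A y = ∑ x, A (bxor x a) * twist (bxor x a) y := by
  show (∑ x, A x * twist x y) = _
  exact (Fintype.sum_equiv (Equiv.mk (fun x => bxor x a) (fun x => bxor x a)
    (fun x => by simp [iw_bxor_assoc]) (fun x => by simp [iw_bxor_assoc]))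
    (fun x => A (bxor x a) * twist (bxor x a) y) (fun x => A x * twist x y) fun x => rfl).symm

/-- **A period up to sign pins the character on the support.** If `A(x ⊕ a) = c·A(x)` for all `x` with `c = ±1`, then
`Â(y) ≠ 0` forces `(−1)^{a·y} = c`. [cite: ODonnell2014, §3.3] -/
theorem fp_twist_eq_of_W_ne_zero (A : (Fin n → Bool) → ℝ) (a : Fin n → Bool) (c : ℝ) (hc : c = 1 ∨ c = -1)
    (hper : ∀ x, A (bxor x a) = c * A x) (y : Fin n → Bool) (hy : W A y ≠ 0) : twist a y = c := by
  have hre : W A y = c * twist a y * W A y := by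
    calc W A y = ∑ x, A (bxor x a) * twist (bxor x a) y := fp_W_translate A a y
      _ = ∑ x, c * twist a y * (A x * twist x y) := sum_congr rfl fun x _ => by rw [hper x, twist_bxor_left]; ring
      _ = c * twist a y * W A y := by rw [← mul_sum]; rfl
  have hprod : c * twist a y = 1 := by
    have h1 : (c * twist a y - 1) * W A y = 0 := by linarith
    have h2 := (mul_eq_zero.1 h1).resolve_right hy
    linarith
  rcases Simon.twist_eq_one_or a y with ht | ht <;> rcases hc with h | h
  · rw [ht, h]
  · rw [ht, h] at hprod; norm_num at hprod
  · rw [ht, h] at hprod; norm_num at hprod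
  · rw [ht, h]

/-- **`#supp(Â) · #R ≤ 2ⁿ`** when every element of the `⊕`-closed `R ∋ 0` is a period of `A` up to sign: the support of `Â` lies in
one coset of `R^⊥` (`|R|·|R^⊥| = 2ⁿ`). [cite: ODonnell2014, §3.3] -/
theorem fp_card_supp_mul_le (A : (Fin n → Bool) → ℝ) (R : Finset (Fin n → Bool)) (h0 : zeroVec ∈ R)
    (hadd : ∀ a ∈ R, ∀ b ∈ R, bxor a b ∈ R)
    (hper : ∀ a ∈ R, ∃ c : ℝ, (c = 1 ∨ c = -1) ∧ ∀ x, A (bxor x a) = c * A x) :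
    #(univ.filter fun y : Fin n → Bool => W A y ≠ 0) * #R ≤ 2 ^ n := by
  classical
  set Y := univ.filter (fun y : Fin n → Bool => W A y ≠ 0) with hYdef
  by_cases hY : Y = ∅
  · rw [hY, card_empty, zero_mul]; exact Nat.zero_le _
  obtain ⟨y₀, hy₀⟩ := nonempty_iff_ne_empty.2 hY
  -- the pinned characters agree on `Y`, so `y₀ ⊕ Y ⊆ R^⊥`
  have hpin : ∀ a ∈ R, ∀ y ∈ Y, ∀ y' ∈ Y, twist a y = twist a y' := by
    intro a ha y hy y' hy'
    obtain ⟨c, hc, hc'⟩ := hper a ha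
    rw [fp_twist_eq_of_W_ne_zero A a c hc hc' y (mem_filter.1 hy).2,
      fp_twist_eq_of_W_ne_zero A a c hc hc' y' (mem_filter.1 hy').2]
  have hinj : #Y ≤ #(univ.filter fun z : Fin n → Bool => ∀ a ∈ R, twist a z = 1) := by
    refine card_le_card_of_injOn (fun y => bxor y₀ y) (fun y hy => ?_) (fun y _ y' _ h => ?_)
    · refine mem_filter.2 ⟨mem_univ _, fun a ha => ?_⟩
      rw [twist_bxor_right, hpin a ha y₀ hy₀ y hy]
      rcases Simon.twist_eq_one_or a y with h | h <;> rw [h] <;> norm_num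
    · simpa only [bxor_bxor_cancel_left] using congrArg (bxor y₀) h
  have hperp := card_mul_card_perp h0 hadd
  have h' : ((#Y * #R : ℕ) : ℝ) ≤ ((2 ^ n : ℕ) : ℝ) := by
    push_cast
    calc (#Y : ℝ) * #R ≤ #(univ.filter fun z : Fin n → Bool => ∀ a ∈ R, twist a z = 1) * #R := by
          exact mul_le_mul_of_nonneg_right (by exact_mod_cast hinj) (Nat.cast_nonneg _)
      _ = 2 ^ n := by rw [mul_comm]; exact hperp
  exact_mod_cast h'

/-- Parseval for a function that is `±1` on `S` and `0` off `S`: `Σ_y Â(y)² = 2ⁿ·#S`. [cite: ODonnell2014, §1.4] -/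
theorem fp_parseval_pm (A : (Fin n → Bool) → ℝ) (S : Finset (Fin n → Bool)) (hA1 : ∀ x ∈ S, A x = 1 ∨ A x = -1)
    (hA0 : ∀ x, x ∉ S → A x = 0) : ∑ y, W A y ^ 2 = (2 : ℝ) ^ n * #S := by
  classical
  rw [sum_W_sq]
  congr 1
  have hsq : ∀ x, A x ^ 2 = if x ∈ S then (1 : ℝ) else 0 := by
    intro x
    by_cases hx : x ∈ S
    · rw [if_pos hx]; rcases hA1 x hx with h | h <;> rw [h] <;> norm_num
    · rw [if_neg hx, hA0 x hx]; norm_num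
  rw [sum_congr rfl fun x _ => hsq x, sum_boole]
  simp

/-- **The `L¹` bound from periods.**  `A` is `±1` on `S`, `0` off `S`; every element of the `⊕`-closed `R ∋ 0` is a period of `A` up
to sign.  Then `(Σ_y |Â(y)|)² · #R ≤ 2ⁿ · 2ⁿ · #S` (Cauchy–Schwarz on the support, `#supp·#R ≤ 2ⁿ`, Parseval). [this work] -/
theorem fp_l1_sq_mul_le (A : (Fin n → Bool) → ℝ) (S R : Finset (Fin n → Bool)) (hA1 : ∀ x ∈ S, A x = 1 ∨ A x = -1)
    (hA0 : ∀ x, x ∉ S → A x = 0) (h0 : zeroVec ∈ R) (hadd : ∀ a ∈ R, ∀ b ∈ R, bxor a b ∈ R)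
    (hper : ∀ a ∈ R, ∃ c : ℝ, (c = 1 ∨ c = -1) ∧ ∀ x, A (bxor x a) = c * A x) :
    (∑ y, |W A y|) ^ 2 * #R ≤ (2 : ℝ) ^ n * 2 ^ n * #S := by
  classical
  set Y := univ.filter (fun y : Fin n → Bool => W A y ≠ 0) with hYdef
  have hsupp := fp_card_supp_mul_le A R h0 hadd hper
  have hP := fp_parseval_pm A S hA1 hA0
  -- the `L¹` norm lives on `Y`
  have hL1 : ∑ y, |W A y| = ∑ y ∈ Y, |W A y| * 1 := by
    rw [← sum_filter_add_sum_filter_not univ (fun y : Fin n → Bool => W A y ≠ 0)]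
    have hz : ∑ y ∈ univ.filter (fun y : Fin n → Bool => ¬ W A y ≠ 0), |W A y| = 0 :=
      sum_eq_zero fun y hy => by
        have : W A y = 0 := by simpa using (mem_filter.1 hy).2
        rw [this, abs_zero]
    rw [hz, add_zero]
    exact sum_congr rfl fun y _ => (mul_one _).symm
  -- Cauchy–Schwarz on `Y`
  have hCS := sum_mul_sq_le_sq_mul_sq Y (fun y => |W A y|) (fun _ => (1 : ℝ))
  have h1 : ∑ y ∈ Y, (1 : ℝ) ^ 2 = #Y := by simp
  have h2 : ∑ y ∈ Y, |W A y| ^ 2 ≤ (2 : ℝ) ^ n * #S := by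
    rw [← hP, ← sum_filter_add_sum_filter_not univ (fun y : Fin n → Bool => W A y ≠ 0)]
    have hnn : 0 ≤ ∑ y ∈ univ.filter (fun y : Fin n → Bool => ¬ W A y ≠ 0), W A y ^ 2 :=
      sum_nonneg fun y _ => sq_nonneg _
    have he : ∑ y ∈ Y, |W A y| ^ 2 = ∑ y ∈ Y, W A y ^ 2 := sum_congr rfl fun y _ => sq_abs _
    rw [he]
    linarith
  rw [h1] at hCS
  rw [hL1]
  have hR0 : (0 : ℝ) ≤ #R := Nat.cast_nonneg _
  have hYR : (#Y : ℝ) * #R ≤ 2 ^ n := by exact_mod_cast hsupp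
  calc (∑ y ∈ Y, |W A y| * 1) ^ 2 * #R ≤ ((∑ y ∈ Y, |W A y| ^ 2) * #Y) * #R :=
        mul_le_mul_of_nonneg_right hCS hR0
    _ ≤ ((2 : ℝ) ^ n * #S * #Y) * #R := by
        refine mul_le_mul_of_nonneg_right (mul_le_mul_of_nonneg_right h2 (Nat.cast_nonneg _)) hR0
    _ = (2 : ℝ) ^ n * #S * (#Y * #R) := by ring
    _ ≤ (2 : ℝ) ^ n * #S * 2 ^ n := mul_le_mul_of_nonneg_left hYR (by positivity)
    _ = (2 : ℝ) ^ n * 2 ^ n * #S := by ring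

end Summit.QuantumAdvantage.QuantumAdvantage.Theorems.CubicForrelation.NearExactIsExact

end
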